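import Summits.AtomisticToContinuum.BoseEinsteinCondensation.Theorems.BECProbeMassFlowRecoilTransferOfMassFlow
import Summits.AtomisticToContinuum.BoseEinsteinCondensation.Theorems.BECProbeMassFlowCloudMomentumAtomFreeZeroMomentum
import HarnessLib

/-!
# Route `BECProbeMassFlow`, crux `RecoilTransfer` (stmt-AtomisticToContinuum-12311):
# the statement-level sandwich with COMPLETE CONDENSATION of the `(N+1)`-boson torus gas

Support file for the crux `RecoilTransfer` ("recoil costs at most `ε`"), line `registered` (lead c3). It records
IN THE TREE the two elementary implications that locate the crux relative to the open problem of the conjunct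
(complete Bose–Einstein condensation of the dilute periodic gas in the thermodynamic limit, every `ε > 0`, small
`ρ`, eventually in `N`) — previously only in refuter evidence files (`Sandwich.lean`, `Sandwich3.lean` on the item):

* `recoilTransfer_of_completeCondensation` — complete condensation (stated INLINE as a hypothesis, in the
  canonical shape `N` bosons on the torus of side `sideLength ρ N`, exactly as in the sibling route's
  `beliaevDeformationBound_of_completeCondensation`) implies `RecoilTransfer`, and the static-floor hypothesis of
  the crux is IDLE in this direction: it is used only to see `c ≤ 1` (`recoilTransfer_floor_le_one`: near-minimisers
  of the pinned problem exist and have `L⁶ w₀ ≤ L⁶`, `recoilTransfer_translationAverage_sq_le`; in the degenerate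
  branch `E_imp = ⊤` the zero-weight plane wave of `recoilTransfer_exists_zeroWeight` even gives `c ≤ 0`).
* `completeCondensation_succ_of_cloudMomentumAtom` / `completeCondensation_of_cloudMomentumAtom` — conversely the
  two cruxes of the route together (`CloudMomentumAtom`, `RecoilTransfer`) give complete condensation of the
  `(N+1)`-boson gas on the torus of side `sideLength ρ (N+1)` (`ε/2 + ε/2`), hence, re-indexing
  (`Filter.map_add_atTop_eq_nat`), complete condensation in the canonical shape.

So, GIVEN the sibling crux, `RecoilTransfer` is equivalent to complete torus condensation — strictly stronger than
the `PeriodicBEC(c = 1/2)` body the route's glue feeds to `BoundaryTransferWeak`. A second route of the conjunct meets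
the same statement (`Theorems/BECRichardsonGaudinBeliaevDeformationBoundComparisonOfCondensation.lean`).
No definition is introduced (the open statement is written inline, as a hypothesis or a conclusion); theorems only.
-/

noncomputable section

open MeasureTheory Filter
open scoped ENNReal NNReal

namespace Summit.AtomisticToContinuum.BoseEinsteinCondensation.Theorems

open Literature.MathematicalPhysics.QuantumManyBody
open Literature.MathematicalPhysics.QuantumManyBody.BoseGas
open Summit.AtomisticToContinuum.BoseEinsteinCondensation.Theses.BECProbeMassFlow
open Summit.AtomisticToContinuum.BoseEinsteinCondensation.Cruxes.PeriodicIRBound.LinearPhFloorWagner.WF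
open Summit.AtomisticToContinuum.BoseEinsteinCondensation.Cruxes.CloudMomentumAtom.Birth (normSq_comProj_eq)

/-! ### `w₀ ≤ 1`: the translation average of a normalised state has `L⁶ w₀ ≤ L⁶` -/

/-- **`L⁶ w₀(Φ) ≤ L⁶`.** For a periodic trial state `Φ` of `N` bosons on the torus of side `L > 0`,
`∫⁻_{cell^N} ‖∫_{cell} Φ(X + t𝟙) dt‖₊² ≤ L⁶`: the left side is `L⁶ ‖PΦ‖²` for the centre-of-mass projection
`P = L⁻³∫ T_t dt` (`normSq_comProj_eq`), and `‖PΦ‖² ≤ ‖Φ‖² = 1` by Pythagoras in the centre of mass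
(`comProj_pythagoras`). [folklore] -/
theorem recoilTransfer_translationAverage_sq_le {N : ℕ} {L : ℝ} (hL : 0 < L) {v : ℝ → ℝ≥0∞} (hv : Measurable v)
    (Φ : PeriodicTrialState N L) :
    ∫⁻ X in cellN N L, (‖∫ t in cell L, Φ.ψ (X + fun _ => t)‖₊ : ℝ≥0∞) ^ 2 ≤ ENNReal.ofReal (L ^ 6) := by
  set W : ℝ≥0∞ := ∫⁻ X in cellN N L, (‖∫ t in cell L, Φ.ψ (X + fun _ => t)‖₊ : ℝ≥0∞) ^ 2 with hW
  have hL6 : 0 < L ^ 6 := by positivity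
  -- `‖PΦ‖² ≤ ‖Φ‖² = 1`
  have hPy := (comProj_pythagoras hL hv (isCore_trialState Φ)).1
  have h1 : normSq L Φ.ψ = 1 := Φ.norm_eq
  have hle : normSq L (comProj L Φ.ψ) ≤ 1 := by
    calc normSq L (comProj L Φ.ψ)
        ≤ normSq L (comProj L Φ.ψ) + normSq L (fun X => Φ.ψ X - comProj L Φ.ψ X) := le_self_add
      _ = 1 := by rw [← hPy, h1]
  -- unscale: `‖PΦ‖² = L⁻⁶ W`
  rw [normSq_comProj_eq hL Φ.ψ, ← hW] at hle
  have hkey : ENNReal.ofReal (L ^ 6) * (ENNReal.ofReal ((L ^ 6)⁻¹) * W) ≤ ENNReal.ofReal (L ^ 6) * 1 := by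
    gcongr
  rwa [mul_one, ← mul_assoc, ← ENNReal.ofReal_mul hL6.le, mul_inv_cancel₀ hL6.ne', ENNReal.ofReal_one,
    one_mul] at hkey

/-! ### The static floor can only hold with `c ≤ 1` -/

/-- **A `w₀`-floor `c` on the pinned `δ₁`-near-minimisers forces `c ≤ 1`** (`L > 0`, `δ₁ > 0`, measurable `v`):
if `E_imp < ⊤` a `δ₁`-near-minimiser exists and has `L⁶ w₀ ≤ L⁶`; if `E_imp = ⊤` every state is a near-minimiser,
and for `N ≥ 1` the symmetrised plane wave has `w₀ = 0` (so even `c ≤ 0`), while `N = 0` has `E_imp = 0 < ⊤`.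
This is the only use the sandwich makes of the crux's hypothesis. [folklore] -/
theorem recoilTransfer_floor_le_one {N : ℕ} {L : ℝ} (hL : 0 < L) {v : ℝ → ℝ≥0∞} (hv : Measurable v)
    {c : ℝ} {δ₁ : ℝ≥0∞} (hδ₁ : 0 < δ₁)
    (hfloor : ∀ Φ : PeriodicTrialState N L,
      impurityPeriodicEnergy v 0 Φ ≤ impurityPeriodicGroundStateEnergy v N L 0 + δ₁ →
        ENNReal.ofReal (c * L ^ 6) ≤
          ∫⁻ X in cellN N L, (‖∫ t in cell L, Φ.ψ (X + fun _ => t)‖₊ : ℝ≥0∞) ^ 2) :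
    c ≤ 1 := by
  have hL6 : 0 < L ^ 6 := by positivity
  by_contra hc
  rw [not_le] at hc
  set E := impurityPeriodicGroundStateEnergy v N L 0 with hE_def
  by_cases hE : E = ⊤
  · -- degenerate branch: `N ≥ 1` (as `E_imp(0 bosons) = 0`) and the zero-weight witness
    have hN : 0 < N := by
      rcases Nat.eq_zero_or_pos N with h0 | h0
      · exact absurd hE (by rw [hE_def, h0]; exact recoilTransfer_impurityEnergy_zero_bosons v L)
      · exact h0
    obtain ⟨Φ, hW⟩ := recoilTransfer_exists_zeroWeight hL hN
    have h := hfloor Φ (by rw [hE, top_add]; exact le_top)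
    rw [hW, nonpos_iff_eq_zero, ENNReal.ofReal_eq_zero] at h
    have : 0 < c * L ^ 6 := by
      have hc0 : 0 < c := lt_trans one_pos hc
      positivity
    linarith
  · -- finite pinned infimum: a `δ₁`-near-minimiser exists and has `W ≤ L⁶ < c L⁶`
    have hEs : E < E + δ₁ := ENNReal.lt_add_right hE hδ₁.ne'
    obtain ⟨Φ, hΦ⟩ : ∃ Φ : PeriodicTrialState N L, impurityPeriodicEnergy v 0 Φ < E + δ₁ := iInf_lt_iff.1 hEs
    have h := (hfloor Φ hΦ.le).trans (recoilTransfer_translationAverage_sq_le hL hv Φ)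
    have h' : c * L ^ 6 ≤ L ^ 6 := (ENNReal.ofReal_le_ofReal_iff hL6.le).1 h
    nlinarith

/-! ### Complete condensation ⟹ `RecoilTransfer` (the static floor is idle) -/

/-- **Complete condensation of the dilute periodic gas implies the crux `RecoilTransfer`.** If for every
repulsive finite-range `v` and every `ε > 0` there is `ρ₀ > 0` such that for `0 < ρ < ρ₀`, eventually in `N`,
some `δ > 0` makes every periodic `N`-boson trial state `Ψ` on the torus of side `(N/ρ)^{1/3}` with
`⟨Ψ, HΨ⟩ ≤ E₀^per + δ` satisfy `n₀(Ψ) ≥ (1 - ε)N` (complete BEC in the dilute limit, thermodynamic limit first —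
the open problem; stated inline, consumed as a hypothesis only), then `RecoilTransfer` holds: at `N + 1` bosons the
hypothesis gives `n₀ ≥ (1 - ε)(N+1)` on the `δ`-near-minimisers, the crux's floor hypothesis forces `c ≤ 1`
(`recoilTransfer_floor_le_one`), and `(c - ε)(N+1) ≤ (1 - ε)(N+1)`. [folklore] -/
theorem recoilTransfer_of_completeCondensation :
    (∀ v : ℝ → ℝ≥0∞, IsRepulsiveFiniteRange v → ∀ ε : ℝ, 0 < ε → ∃ ρ₀ : ℝ, 0 < ρ₀ ∧ ∀ ρ : ℝ, 0 < ρ → ρ < ρ₀ →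
      ∀ᶠ N : ℕ in Filter.atTop, ∃ δ : ℝ≥0∞, 0 < δ ∧ ∀ Ψ : PeriodicTrialState N (sideLength ρ N),
        periodicEnergy v Ψ ≤ periodicGroundStateEnergy v N (sideLength ρ N) + δ →
          ENNReal.ofReal ((1 - ε) * N) ≤ condensateOccupation N (sideLength ρ N) Ψ.ψ) →
      Summit.AtomisticToContinuum.BoseEinsteinCondensation.Theses.BECProbeMassFlow.RecoilTransfer := by
  intro h v hv ε hε
  obtain ⟨ρ₀, hρ₀, H⟩ := h v hv ε hε
  refine ⟨ρ₀, hρ₀, fun ρ hρ hρlt => ?_⟩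
  -- re-index the hypothesis at `N + 1` bosons
  have H1 : ∀ᶠ N : ℕ in atTop, ∃ δ : ℝ≥0∞, 0 < δ ∧
      ∀ Ψ : PeriodicTrialState (N + 1) (sideLength ρ (N + 1)),
        periodicEnergy v Ψ ≤ periodicGroundStateEnergy v (N + 1) (sideLength ρ (N + 1)) + δ →
          ENNReal.ofReal ((1 - ε) * ((N + 1 : ℕ) : ℝ)) ≤
            condensateOccupation (N + 1) (sideLength ρ (N + 1)) Ψ.ψ :=
    (tendsto_add_atTop_nat 1).eventually (H ρ hρ hρlt)
  filter_upwards [H1] with N hN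
  intro c δ₁ hδ₁ hfloor
  have hL : 0 < sideLength ρ (N + 1) := by
    unfold sideLength
    exact Real.rpow_pos_of_pos (div_pos (by exact_mod_cast Nat.succ_pos N) hρ) _
  -- the floor forces `c ≤ 1`
  have hc : c ≤ 1 := recoilTransfer_floor_le_one hL hv.1 hδ₁ hfloor
  obtain ⟨δ, hδ, hΩ⟩ := hN
  refine ⟨δ, hδ, fun Ω hΩE => le_trans (ENNReal.ofReal_le_ofReal ?_) (hΩ Ω hΩE)⟩
  exact mul_le_mul_of_nonneg_right (by linarith) (Nat.cast_nonneg _)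

/-! ### `CloudMomentumAtom ∧ RecoilTransfer` ⟹ complete condensation of the `(N+1)`-boson gas -/

/-- **The two cruxes give complete condensation of the `(N+1)`-boson torus gas** (box convention of the
route: `N + 1` bosons on the torus of side `sideLength ρ (N+1)`): `CloudMomentumAtom` with `ε/2` is the floor
hypothesis of `RecoilTransfer` with `c = 1 - ε/2` (syntactically the same `ofReal((1 - ε/2)·L⁶)` term), whence
`δ₂` with `n₀ ≥ (1 - ε/2 - ε/2)(N+1) = (1 - ε)(N+1)` on the `δ₂`-near-minimisers; `ρ₀ = min`, intersection of
the two eventual-`N` sets. Pure logic. [folklore] -/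
theorem completeCondensation_succ_of_cloudMomentumAtom (h1 : CloudMomentumAtom) (h2 : RecoilTransfer) :
    ∀ v : ℝ → ℝ≥0∞, IsRepulsiveFiniteRange v → ∀ ε : ℝ, 0 < ε →
      ∃ ρ₀ : ℝ, 0 < ρ₀ ∧ ∀ ρ : ℝ, 0 < ρ → ρ < ρ₀ → ∀ᶠ N : ℕ in atTop,
        ∃ δ : ℝ≥0∞, 0 < δ ∧ ∀ Ω : PeriodicTrialState (N + 1) (sideLength ρ (N + 1)),
          periodicEnergy v Ω ≤ periodicGroundStateEnergy v (N + 1) (sideLength ρ (N + 1)) + δ →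
            ENNReal.ofReal ((1 - ε) * ((N + 1 : ℕ) : ℝ)) ≤
              condensateOccupation (N + 1) (sideLength ρ (N + 1)) Ω.ψ := by
  intro v hv ε hε
  obtain ⟨ρ₁, hρ₁, H₁⟩ := h1 v hv (ε / 2) (half_pos hε)
  obtain ⟨ρ₂, hρ₂, H₂⟩ := h2 v hv (ε / 2) (half_pos hε)
  refine ⟨min ρ₁ ρ₂, lt_min hρ₁ hρ₂, fun ρ hρ hρlt => ?_⟩
  filter_upwards [H₁ ρ hρ (hρlt.trans_le (min_le_left _ _)),
    H₂ ρ hρ (hρlt.trans_le (min_le_right _ _))] with N hN₁ hN₂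
  obtain ⟨δ₁, hδ₁, hfloor⟩ := hN₁
  obtain ⟨δ₂, hδ₂, hΩ⟩ := hN₂ (1 - ε / 2) δ₁ hδ₁ hfloor
  refine ⟨δ₂, hδ₂, fun Ω hΩE => ?_⟩
  have hce : 1 - ε / 2 - ε / 2 = 1 - ε := by ring
  simpa only [hce] using hΩ Ω hΩE

/-- **The two cruxes give complete condensation in the canonical shape** (`N` bosons on the torus of side
`sideLength ρ N`, eventually in `N`): re-index `completeCondensation_succ_of_cloudMomentumAtom` by
`Filter.map_add_atTop_eq_nat`. Together with `recoilTransfer_of_completeCondensation`: GIVEN `CloudMomentumAtom`,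
the crux `RecoilTransfer` is equivalent to complete condensation of the dilute periodic gas. [folklore] -/
theorem completeCondensation_of_cloudMomentumAtom :
    Summit.AtomisticToContinuum.BoseEinsteinCondensation.Theses.BECProbeMassFlow.CloudMomentumAtom →
      Summit.AtomisticToContinuum.BoseEinsteinCondensation.Theses.BECProbeMassFlow.RecoilTransfer →
        ∀ v : ℝ → ℝ≥0∞, IsRepulsiveFiniteRange v → ∀ ε : ℝ, 0 < ε → ∃ ρ₀ : ℝ, 0 < ρ₀ ∧ ∀ ρ : ℝ, 0 < ρ → ρ < ρ₀ →
          ∀ᶠ N : ℕ in Filter.atTop, ∃ δ : ℝ≥0∞, 0 < δ ∧ ∀ Ψ : PeriodicTrialState N (sideLength ρ N),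
            periodicEnergy v Ψ ≤ periodicGroundStateEnergy v N (sideLength ρ N) + δ →
              ENNReal.ofReal ((1 - ε) * N) ≤ condensateOccupation N (sideLength ρ N) Ψ.ψ := by
  intro h1 h2 v hv ε hε
  obtain ⟨ρ₀, hρ₀, H⟩ := completeCondensation_succ_of_cloudMomentumAtom h1 h2 v hv ε hε
  refine ⟨ρ₀, hρ₀, fun ρ hρ hρlt => ?_⟩
  have h : ∀ᶠ M : ℕ in Filter.map (fun a : ℕ => a + 1) atTop,
      ∃ δ : ℝ≥0∞, 0 < δ ∧ ∀ Ψ : PeriodicTrialState M (sideLength ρ M),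
        periodicEnergy v Ψ ≤ periodicGroundStateEnergy v M (sideLength ρ M) + δ →
          ENNReal.ofReal ((1 - ε) * M) ≤ condensateOccupation M (sideLength ρ M) Ψ.ψ :=
    Filter.eventually_map.2 (H ρ hρ hρlt)
  rwa [Filter.map_add_atTop_eq_nat 1] at h

/-- **The sandwich, packaged**: given `CloudMomentumAtom`, `RecoilTransfer` holds iff the dilute periodic gas
condenses completely (complete condensation stated inline). [folklore] -/
theorem recoilTransfer_iff_completeCondensation_of_cloudMomentumAtom (h1 : CloudMomentumAtom) :
    RecoilTransfer ↔
      ∀ v : ℝ → ℝ≥0∞, IsRepulsiveFiniteRange v → ∀ ε : ℝ, 0 < ε →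
        ∃ ρ₀ : ℝ, 0 < ρ₀ ∧ ∀ ρ : ℝ, 0 < ρ → ρ < ρ₀ → ∀ᶠ N : ℕ in atTop,
          ∃ δ : ℝ≥0∞, 0 < δ ∧ ∀ Ψ : PeriodicTrialState N (sideLength ρ N),
            periodicEnergy v Ψ ≤ periodicGroundStateEnergy v N (sideLength ρ N) + δ →
              ENNReal.ofReal ((1 - ε) * N) ≤ condensateOccupation N (sideLength ρ N) Ψ.ψ :=
  ⟨completeCondensation_of_cloudMomentumAtom h1, recoilTransfer_of_completeCondensation⟩

end Summit.AtomisticToContinuum.BoseEinsteinCondensation.Theorems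

end
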